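import Mathlib
import HarnessLib
import Literature.AlgebraicGeometry.Resolution.ExcellentRingsFieldProofs
import Literature.AlgebraicGeometry.Resolution.ExcellentRingsEssFiniteType
import Summits.ResolutionOfSingularities.ResolutionOfSingularities.Theorems.HomologicalConductorNoZenoSkyPointModel
import Summits.ResolutionOfSingularities.ResolutionOfSingularities.Theorems.HomologicalConductorNoZenoResolutionThrough

/-!
# Crux `NoZeno` / `NoZenoR` (stmt-ResolutionOfSingularities-16483 / -19943), line `sandwich-cluster`,
# registered stub `stub_skyPointLifts` (P1.3′, skeleton v17–v20 signature): modulo Cossart–Jannsen–Saito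
# Thm 1.2, a sky point of the singular stage lifts to every minimal resolution

Route `ResolutionOfSingularities/HomologicalConductor`.  OURS (cell res-hironaka, crux chain W4.4, seat
res-D-pv-038 acting as res-L0-w44-stub-6; CHAIN v6 row «stub-6»); nothing here is a statement of the
manuscript under review (Hironaka 2017); AI-written, weaker than expert review.

`stub_skyPointLifts`: the registered stub (skeleton v17–v20 signature: first binder `hCJS`, then the v15 binders VERBATIM
(sandwich context, singular late stage `T_m = tower O A m`, a sky point `S` — a two-dimensional regular
local `k`-subalgebra `S ⊇ T_m` of `K` dominating `T_m` and `R`, ending a chain of quadratic transforms from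
`R` whose last-but-one member does not contain `T_m` — and an ARBITRARY minimal resolution
`π : X ⟶ Spec T_m`), PLUS the named fact `CossartJannsenSaito2020General` (Cossart–Jannsen–Saito 2020,
Thm 1.2, «the resolution is an isomorphism over `Reg`»): there is `l : Spec S ⟶ X` with
`l ≫ π = Spec (T_m ↪ S)`.  Assembly:

1. `T_m` is a Noetherian excellent local domain of dimension `2` with `Frac T_m = K`
   (`stage_package`; excellence: `T_m` is essentially of finite type over the field `k`,
   `tn_tower_invariant` + `isExcellentRing_of_field` + `IsExcellentRing.of_essFiniteType`);
2. `S` is essentially of finite type over `T_m` — the ring half of P1.3 (`skyPoint_exists_finset`,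
   `HomologicalConductorNoZenoSkyPointModel`): `S = T_m[t]_𝔮` for a finite `t ⊆ S`;
3. hence `S = (B₀)_𝔮` for the finitely generated model `B₀ = EssFiniteType.subalgebra T_m S ⊆ S`, which has
   a common denominator over `T_m` (`exists_denominator_adjoin`, stub-3's `StageRational`);
4. `exists_isResolution_through_of_cjsGeneral` (`HomologicalConductorNoZenoResolutionThrough`): a
   resolution `ρ : X″ ⟶ Spec T_m` with `j : Spec S ⟶ X″` over `Spec T_m`;
5. minimality of `π`: `X″ ⟶ X`, and `l := j ≫ (X″ ⟶ X)`.

The v15 signature carried no resolution-of-surfaces binder; since v17 (lead res-L0-w44-lead-1, option (a) of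
this seat's note) the registered stub takes `hCJS : CossartJannsenSaito2020General` first — the one named
fact the construction needs (F-04's weak form `CossartJannsenSaito2020` does not suffice: a resolution blowing
up the regular point `S` loses it).  This file proves the registered name and signature.

References: V. Cossart, U. Jannsen, S. Saito, LNM 2270 (2020), Thm 1.2 [`CossartJannsenSaito2020`];
S. Abhyankar, Amer. J. Math. 78 (1956), Thm. 3 [`Abhyankar1956Valuations`]; J. Lipman, Publ. Math. IHÉS
36 (1969), §4 [`Lipman1969`].
-/

noncomputable section

-- single-problem summit: the doubled namespace component `ResolutionOfSingularities` is forced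
set_option linter.dupNamespace false

namespace Summit.ResolutionOfSingularities.ResolutionOfSingularities.Theorems.NoZeno.SandwichCluster

open CategoryTheory AlgebraicGeometry TopologicalSpace IsLocalRing
open Literature.AlgebraicGeometry.Resolution Literature.AlgebraicGeometry.Morphisms
open Summit.ResolutionOfSingularities.ResolutionOfSingularities.Theorems
open Summit.ResolutionOfSingularities.ResolutionOfSingularities.Theorems.NoZeno.Birth
open Summit.ResolutionOfSingularities.ResolutionOfSingularities.Theses.HomologicalConductor

variable {k K : Type} [Field k] [Field K] [Algebra k K]

/-! ## A sky point is essentially of finite type over the stage -/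

/-- **A sky point is essentially of finite type over `k`** (hence over the stage `T_m`): by the ring half
of P1.3 (`skyPoint_exists_finset`) `S` is the localisation, at the elements invertible in `S`, of the
`k`-algebra `k[T_m ∪ t]` for a finite `t ⊆ S`, and `T_m` is essentially of finite type over `k`
(`tn_tower_invariant`). [cite: Abhyankar1956Valuations, Thm. 3] -/
theorem skyPoint_essFiniteType (p : ℕ) (hp : p.Prime) (k K : Type) [Field k] [CharP k p]
    [Field K] [Algebra k K] (O : ValuationSubring K) (A R : Subalgebra k K) (m₀ : ℕ)
    (ctx : SandwichCtx O A R m₀) (m : ℕ) (hm : m₀ + 1 ≤ m)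
    (S : Subalgebra k K) (hTS : tower O A m ≤ S) (hS : IsRegularLocalRing ↥S) (hS2 : ringKrullDim ↥S = 2)
    (hdomR : SubringDominates R.toSubring S.toSubring)
    (hsky : ∃ Q : Subring K, Relation.ReflTransGen IsQuadraticTransform R.toSubring Q ∧
      IsQuadraticTransform Q S.toSubring ∧ ¬ (tower O A m).toSubring ≤ Q) :
    Algebra.EssFiniteType k ↥S := by
  obtain ⟨hk, hA, hfr, hAO, -, -, -, -, -, -⟩ := id ctx
  have hET : Algebra.EssFiniteType k ↥(tower O A m) := (tn_tower_invariant O A hk hA hfr hAO m).2.2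
  obtain ⟨t, htS, -, hfrac⟩ :=
    skyPoint_exists_finset p hp k K O A R m₀ ctx m hm S hTS hS hS2 hdomR hsky
  let C : Subalgebra k K := Algebra.adjoin k (((tower O A m) : Set K) ∪ ↑t)
  have hCS : C ≤ S := Algebra.adjoin_le (Set.union_subset (fun x hx => hTS hx) htS)
  have hcl : Subring.closure (((tower O A m).toSubring : Set K) ∪ ↑t) ≤ C.toSubring :=
    Subring.closure_le.mpr Algebra.subset_adjoin
  refine tn_essFiniteType_of_frac hCS (tn_essFiniteType_adjoin_union (tower O A m) hET t) ?_
  intro d hd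
  obtain ⟨a, ha, b, hb, hbinv, hdab⟩ := hfrac d hd
  by_cases hb0 : b = 0
  · refine ⟨0, C.zero_mem, 1, C.one_mem, one_ne_zero, by rw [inv_one]; exact S.one_mem, ?_⟩
    rw [hdab, hb0, div_zero, inv_one, zero_mul]
  · exact ⟨a, hcl ha, b, hcl hb, hb0, hbinv, by rw [hdab, div_eq_mul_inv]⟩

/-! ## The registered stub, modulo Cossart–Jannsen–Saito -/

/-- **Registered stub `stub_skyPointLifts` (P1.3′), by name and signature** (skeleton v17–v20: first binder
the named fact Cossart–Jannsen–Saito 2020, Thm 1.2, iso-over-`Reg` form; then the sky-point binders):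
for a sky point `S` of the singular late stage `T_m` and every minimal resolution `π : X ⟶ Spec T_m`
there is `l : Spec S ⟶ X` with `l ≫ π = Spec (T_m ↪ S)` — `S` is the regular local ring `(B₀)_𝔮` of a
point of a birational affine model `Spec B₀ → Spec T_m` of finite type (`skyPoint_essFiniteType`,
`exists_denominator_adjoin`), some resolution of `Spec T_m` passes through it
(`exists_isResolution_through_of_cjsGeneral`), and every resolution factors through `π`.
[cite: CossartJannsenSaito2020, Thm. 1.2] [cite: Lipman1969, Theorem (4.1) (p. 204)] -/
theorem stub_skyPointLifts (hCJS : Literature.AlgebraicGeometry.Resolution.CossartJannsenSaito2020General.{0})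
    (p : ℕ) (hp : p.Prime) (k K : Type) [Field k] [CharP k p] [Field K] [Algebra k K]
    (O : ValuationSubring K) (A R : Subalgebra k K) (m₀ : ℕ) (ctx : SandwichCtx O A R m₀) (m : ℕ)
    (hm : m₀ + 1 ≤ m) (hsing : ¬ IsRegularLocalRing ↥(tower O A m)) (S : Subalgebra k K)
    (hTS : tower O A m ≤ S) (hS : IsRegularLocalRing ↥S) (hS2 : ringKrullDim ↥S = 2)
    (_hdom : ∀ t : K, t ∈ tower O A m → t⁻¹ ∈ S → t⁻¹ ∈ tower O A m)
    (hdomR : Literature.AlgebraicGeometry.Resolution.SubringDominates R.toSubring S.toSubring)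
    (hsky : ∃ Q : Subring K,
      Relation.ReflTransGen Literature.AlgebraicGeometry.Resolution.IsQuadraticTransform R.toSubring Q ∧
      Literature.AlgebraicGeometry.Resolution.IsQuadraticTransform Q S.toSubring ∧
      ¬ (tower O A m).toSubring ≤ Q)
    (X : AlgebraicGeometry.Scheme.{0}) (π : X ⟶ AlgebraicGeometry.Spec (CommRingCat.of ↥(tower O A m)))
    (hπ : Literature.AlgebraicGeometry.Resolution.IsMinimalResolution π) :
    ∃ l : AlgebraicGeometry.Spec (CommRingCat.of ↥S) ⟶ X,
      l ≫ π = AlgebraicGeometry.Spec.map (CommRingCat.ofHom (Subalgebra.inclusion hTS).toRingHom) := by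
  obtain ⟨hk, hA, hfr, hAO, -, -, -, -, -, -⟩ := id ctx
  obtain ⟨hTnoeth, -, hTfr, hTloc, hdimT, -, -⟩ := stage_package O A R m₀ ctx m hm hsing
  haveI := hTnoeth
  haveI := hTfr
  haveI := hTloc
  haveI := hS
  -- `T_m` is excellent
  have hET : Algebra.EssFiniteType k ↥(tower O A m) := (tn_tower_invariant O A hk hA hfr hAO m).2.2
  have hTexc : IsExcellentRing ↥(tower O A m) := (isExcellentRing_of_field k).of_essFiniteType hET
  -- `S` as a `T_m`-algebra, essentially of finite type
  letI : Algebra ↥(tower O A m) ↥S := (Subalgebra.inclusion hTS).toRingHom.toAlgebra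
  haveI : IsScalarTower k ↥(tower O A m) ↥S := IsScalarTower.of_algebraMap_eq fun c => rfl
  haveI : Algebra.EssFiniteType k ↥S :=
    skyPoint_essFiniteType p hp k K O A R m₀ ctx m hm S hTS hS hS2 hdomR hsky
  haveI : Algebra.EssFiniteType ↥(tower O A m) ↥S := Algebra.EssFiniteType.of_comp k ↥(tower O A m) ↥S
  -- the finitely generated model `B₀ ⊆ S` and the prime `𝔮 = 𝔪_S ∩ B₀`
  set B₀ : Subalgebra ↥(tower O A m) ↥S := Algebra.EssFiniteType.subalgebra ↥(tower O A m) ↥S with hB₀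
  let 𝔮 : Ideal ↥B₀ := (maximalIdeal ↥S).comap (algebraMap ↥B₀ ↥S)
  haveI : 𝔮.IsPrime := Ideal.comap_isPrime _ _
  have hsub : Algebra.EssFiniteType.submonoid ↥(tower O A m) ↥S = 𝔮.primeCompl := by
    ext x
    simp only [Algebra.EssFiniteType.submonoid, Submonoid.mem_comap, IsUnit.mem_submonoid_iff,
      Ideal.primeCompl, 𝔮]
    change _ ↔ algebraMap (↥B₀) (↥S) x ∉ maximalIdeal ↥S
    rw [IsLocalRing.mem_maximalIdeal, mem_nonunits_iff, not_not]
  haveI : IsLocalization.AtPrime ↥S 𝔮 := by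
    rw [IsLocalization.AtPrime, ← hsub]; infer_instance
  -- injectivity of `T_m → B₀` and the common denominator
  have hcoe : ∀ a : ↥(tower O A m), (((algebraMap ↥(tower O A m) ↥B₀ a : ↥B₀) : ↥S) : K) = (a : K) :=
    fun a => rfl
  have hinj : Function.Injective (algebraMap ↥(tower O A m) ↥B₀) := by
    intro a b h
    have := congrArg (fun x : ↥B₀ => ((x : ↥S) : K)) h
    simp only [hcoe] at this
    exact Subtype.ext this
  obtain ⟨r, hr0, hden⟩ :=
    exists_denominator_adjoin (tower O A m) S hTS (Algebra.EssFiniteType.finset ↥(tower O A m) ↥S)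
  have hB : ∀ b : ↥B₀, ∃ n : ℕ, ∃ a : ↥(tower O A m),
      algebraMap ↥(tower O A m) ↥B₀ a = algebraMap ↥(tower O A m) ↥B₀ r ^ n * b := by
    intro b
    obtain ⟨n, a, h⟩ := hden b b.2
    refine ⟨n, a, Subtype.ext (Subtype.ext ?_)⟩
    rw [hcoe]
    push_cast
    rw [h]
    rfl
  -- a resolution through `S`, then minimality of `π`
  haveI : IsScalarTower ↥(tower O A m) ↥B₀ ↥S := IsScalarTower.of_algebraMap_eq fun _ => rfl
  obtain ⟨X'', ρ, hρ, j, hj⟩ :=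
    exists_isResolution_through_of_cjsGeneral (R := ↥(tower O A m)) (B := ↥B₀) (S := ↥S)
      hCJS hTexc hdimT.le hinj r hr0 hB 𝔮 hS
  obtain ⟨l, hl⟩ := exists_lift_of_isMinimalResolution_of_through hπ hρ j
  exact ⟨l, by rw [hl, hj]⟩

end Summit.ResolutionOfSingularities.ResolutionOfSingularities.Theorems.NoZeno.SandwichCluster

end
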